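import Literature.NumberTheory.LFunctions.WeilChirpKernels
import HarnessLib

/-!
# The remainder of the chirped Euler–Maclaurin formula is a smooth kernel on the window

For a chirp phase `φ` (`ChirpPhase φ H L Cφ`, `φ(H) = 0`) with Nyquist margin
`L = log 3/(2π) + δ`, `δ > 0`, there is a smooth `Ψ : ℝ → ℂ`, independent of the test function,
such that for every Weil test `h` supported in `[-log 3, log 3]`, with `F(t) = ĥ(1/2+it)`,
`F₁ = (ixh)^`, `F₂ = ((ix)²h)^` on the critical line and `W = F₂/φ' − F₁φ''/φ'²` (`emW`):
`½F(H) − ∫_{t>H} W(t) P(φ(t)) dt = ∫ h(x) Ψ(x) dx`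
(`exists_weil_chirp_remainder_kernel`). This is the bookkeeping step of the Poisson /
Euler–Maclaurin analysis of super-Nyquist chirped sampling: split `W P(φ)` into the near part
(`1 - ρ_H`), the aliased far part (`ρ_H (P + 1/12)`, Fourier modes `k ≠ 0`, non-stationary on the
window) and the mean mode (`ρ_H/12`, one integration by parts), and insert the five kernels of
`WeilChirpKernels.lean`. Sources: Olver (1974), Ch. 8; Stein (1993), VIII §1. Everything is
proved; no definitions, no named facts.
-/

noncomputable section

open Complex Filter Set MeasureTheory
open scoped Real Topology ContDiff
open Literature.Analysis.Fourier

namespace Literature.NumberTheory.LFunctions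

section Remainder

variable {φ : ℝ → ℝ} {H L δ : ℝ} {Cφ : ℕ → ℝ} (hφ : ChirpPhase φ H L Cφ) (hδ : 0 < δ)
  (hL : L = Real.log 3 / (2 * π) + δ) (hφH : φ H = 0)

/-- Pairing a continuous compactly supported `h` with continuous kernels is additive.
[folklore] -/
theorem integral_mul_add_kernel {h k₁ k₂ : ℝ → ℂ} (hh : Continuous h) (hhs : HasCompactSupport h)
    (hk₁ : Continuous k₁) (hk₂ : Continuous k₂) :
    ∫ x, h x * (k₁ x + k₂ x) = (∫ x, h x * k₁ x) + ∫ x, h x * k₂ x := by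
  simp_rw [mul_add]
  exact integral_add ((hh.mul hk₁).integrable_of_hasCompactSupport hhs.mul_right)
    ((hh.mul hk₂).integrable_of_hasCompactSupport hhs.mul_right)

/-- Pairing with a scalar multiple of a kernel. [folklore] -/
theorem integral_mul_const_mul_kernel (h k : ℝ → ℂ) (c : ℂ) :
    ∫ x, h x * (c * k x) = c * ∫ x, h x * k x := by
  rw [← integral_const_mul]
  exact integral_congr_ae (Eventually.of_forall fun x => by ring)

include hφ hδ hL hφH in
/-- **The remainder kernel.** There is a smooth `Ψ` with
`½ĥ(1/2+iH) − ∫_{t>H} W P(φ) = ∫ h Ψ` for every Weil test `h` supported in `[-log 3, log 3]`,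
where `W = emW φ F₁ F₂`, `F₁(t) = (ixh)^(1/2+it)`, `F₂(t) = ((ix)²h)^(1/2+it)`. [folklore] -/
theorem exists_weil_chirp_remainder_kernel :
    ∃ Ψ : ℝ → ℂ, ContDiff ℝ ∞ Ψ ∧ ∀ h : ℝ → ℂ, IsWeilTest h →
      tsupport h ⊆ Icc (-Real.log 3) (Real.log 3) →
      weilMellin h (1 / 2 + H * I) / 2 -
        ∫ t in Ioi H, emW φ (fun t => weilMellin (fun x : ℝ => I * x * h x) (1 / 2 + t * I))
          (fun t => weilMellin (fun x : ℝ => I * x * (I * x * h x)) (1 / 2 + t * I)) t *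
          ((perB2 (φ t) : ℝ) : ℂ) = ∫ x, h x * Ψ x := by
  obtain ⟨Kv, hKv, hKv_id⟩ := exists_weil_alias_kernel_inv_deriv hφ hδ hL
  obtain ⟨Kw, hKw, hKw_id⟩ := exists_weil_alias_kernel_curv hφ hδ hL
  obtain ⟨Nv, hNv, hNv_id⟩ := exists_weil_near_kernel_inv_deriv hφ hφH
  obtain ⟨Nw, hNw, hNw_id⟩ := exists_weil_near_kernel_curv hφ hφH
  obtain ⟨Z, hZ, hZ_id⟩ := exists_weil_zero_kernel hφ
  -- the kernel
  have hofR : ContDiff ℝ ∞ (fun x : ℝ => (x : ℂ)) := ofRealCLM.contDiff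
  have hexp : ContDiff ℝ ∞ (fun x : ℝ => cexp (((x * H : ℝ) : ℂ) * I)) := by
    have h1 : ContDiff ℝ ∞ (fun x : ℝ => ((x * H : ℝ) : ℂ)) :=
      ofRealCLM.contDiff.comp (contDiff_id.mul contDiff_const)
    exact Complex.contDiff_exp.comp (h1.mul contDiff_const)
  have hIx : ContDiff ℝ ∞ (fun x : ℝ => (I * x : ℂ)) := contDiff_const.mul hofR
  refine ⟨fun x => cexp (((x * H : ℝ) : ℂ) * I) / 2 + I * x * (Nw x + Kw x - Z x / 12) +
    (I * x) ^ 2 * (-Nv x - Kv x), ?_, fun h hh hha => ?_⟩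
  · exact ((hexp.div_const 2).add (hIx.mul ((hNw.add hKw).sub (hZ.div_const 12)))).add
      ((hIx.pow 2).mul (hNv.neg.sub hKv))
  -- the test functions `G₁ = ixh`, `G₂ = (ix)²h` and their transforms
  set G₁ : ℝ → ℂ := fun x => I * x * h x with hG₁def
  set G₂ : ℝ → ℂ := fun x => I * x * G₁ x with hG₂def
  have hG₁ : IsWeilTest G₁ := hh.I_mul
  have hG₂ : IsWeilTest G₂ := hG₁.I_mul
  have hG₁a : tsupport G₁ ⊆ Icc (-Real.log 3) (Real.log 3) :=
    tsupport_mul_subset_of_subset (fun x : ℝ => I * x) hha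
  have hG₂a : tsupport G₂ ⊆ Icc (-Real.log 3) (Real.log 3) :=
    tsupport_mul_subset_of_subset (fun x : ℝ => I * x) hG₁a
  set F₁ : ℝ → ℂ := fun t => weilMellin G₁ (1 / 2 + t * I) with hF₁def
  set F₂ : ℝ → ℂ := fun t => weilMellin G₂ (1 / 2 + t * I) with hF₂def
  show weilMellin h (1 / 2 + H * I) / 2 -
    ∫ t in Ioi H, emW φ F₁ F₂ t * ((perB2 (φ t) : ℝ) : ℂ) = _
  -- notation for the weights
  set ρ : ℝ → ℝ := rhoCut H with hρ
  set v : ℝ → ℝ := fun t => (deriv φ t)⁻¹ with hv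
  set w : ℝ → ℝ := fun t => deriv (deriv φ) t * (deriv φ t)⁻¹ * (deriv φ t)⁻¹ with hw
  set P : ℝ → ℝ := fun t => perB2 (φ t) with hP
  have hne : ∀ t, H < t → deriv φ t ≠ 0 := fun t ht => (hφ.pos.trans_le (hφ.deriv_ge t ht.le)).ne'
  have hvc : ContinuousOn v (Ioi H) := hφ.contDiff_deriv.continuous.continuousOn.inv₀ hne
  have h2c : Continuous (deriv (deriv φ)) :=
    (contDiff_infty_iff_deriv.1 hφ.contDiff_deriv).2.continuous
  have hwc : ContinuousOn w (Ioi H) := (h2c.continuousOn.mul hvc).mul hvc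
  have hρc : Continuous ρ := (contDiff_rhoCut H).continuous
  have hPc : Continuous P := continuous_perB2.comp hφ.smooth.continuous
  have hLi : 0 ≤ L⁻¹ := inv_nonneg.mpr hφ.pos.le
  have hvB : ∀ t, H < t → |v t| ≤ L⁻¹ := fun t ht => by
    have hL' := hφ.deriv_ge t ht.le
    simp only [hv]
    rw [abs_of_pos (inv_pos.mpr (hφ.pos.trans_le hL'))]
    exact inv_anti₀ hφ.pos hL'
  have hwB : ∀ t, H < t → |w t| ≤ 2 * max (Cφ 2) 0 * L⁻¹ * L⁻¹ := fun t ht => by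
    simp only [hw]
    rw [abs_mul, abs_mul]
    exact mul_le_mul (mul_le_mul (hφ.abs_deriv_deriv_le ht.le) (hvB t ht) (abs_nonneg _)
      (by positivity)) (hvB t ht) (abs_nonneg _) (by positivity)
  have hρB : ∀ t, |ρ t| ≤ 1 := abs_rhoCut_le H
  have hPB : ∀ t, |P t| ≤ 1 := fun t => (abs_perB2_le _).trans (by norm_num)
  have hPB' : ∀ t, |P t + 1 / 12| ≤ 2 := fun t => by
    have := abs_perB2_le (φ t); simp only [hP]; rw [abs_le] at this ⊢
    constructor <;> linarith [this.1, this.2]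
  -- integrability of the five pieces (bounded continuous weights against `F₁`, `F₂`)
  have hint : ∀ {G : ℝ → ℂ}, IsWeilTest G → ∀ {b : ℝ → ℝ} (B : ℝ), 0 ≤ B →
      ContinuousOn b (Ioi H) → (∀ t, H < t → |b t| ≤ B) →
      IntegrableOn (fun t : ℝ => weilMellin G (1 / 2 + t * I) * (b t : ℂ)) (Ioi H) := by
    intro G hG b B hB hb hbB
    exact integrableOn_weilMellin_line_mul hG hb (fun t ht => le_mul_one_add_sq hB (hbB t ht))
  have i1 : IntegrableOn (fun t => F₂ t * (((1 - ρ t) * v t * P t : ℝ) : ℂ)) (Ioi H) := by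
    refine hint hG₂ (2 * L⁻¹ * 1) (by positivity)
      (((continuous_const.sub hρc).continuousOn.mul hvc).mul hPc.continuousOn) fun t ht => ?_
    rw [abs_mul, abs_mul]
    refine mul_le_mul (mul_le_mul ?_ (hvB t ht) (abs_nonneg _) (by norm_num)) (hPB t)
      (abs_nonneg _) (by positivity)
    have := hρB t; rw [abs_le] at this ⊢; constructor <;> linarith [this.1, this.2]
  have i2 : IntegrableOn (fun t => F₁ t * (((1 - ρ t) * w t * P t : ℝ) : ℂ)) (Ioi H) := by
    refine hint hG₁ (2 * (2 * max (Cφ 2) 0 * L⁻¹ * L⁻¹) * 1) (by positivity)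
      (((continuous_const.sub hρc).continuousOn.mul hwc).mul hPc.continuousOn) fun t ht => ?_
    rw [abs_mul, abs_mul]
    refine mul_le_mul (mul_le_mul ?_ (hwB t ht) (abs_nonneg _) (by norm_num)) (hPB t)
      (abs_nonneg _) (by positivity)
    have := hρB t; rw [abs_le] at this ⊢; constructor <;> linarith [this.1, this.2]
  have i3 : IntegrableOn (fun t => F₂ t * ((ρ t * v t : ℝ) : ℂ) * ((P t + 1 / 12 : ℝ) : ℂ))
      (Ioi H) := by
    have := hint hG₂ (b := fun t => ρ t * v t * (P t + 1 / 12)) (1 * L⁻¹ * 2) (by positivity)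
      ((hρc.continuousOn.mul hvc).mul (hPc.continuousOn.add continuousOn_const)) fun t ht => by
        rw [abs_mul, abs_mul]
        exact mul_le_mul (mul_le_mul (hρB t) (hvB t ht) (abs_nonneg _) zero_le_one) (hPB' t)
          (abs_nonneg _) (by positivity)
    refine this.congr_fun (fun t _ => ?_) measurableSet_Ioi
    push_cast; ring
  have i4 : IntegrableOn (fun t => F₁ t * ((ρ t * w t : ℝ) : ℂ) * ((P t + 1 / 12 : ℝ) : ℂ))
      (Ioi H) := by
    have := hint hG₁ (b := fun t => ρ t * w t * (P t + 1 / 12))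
      (1 * (2 * max (Cφ 2) 0 * L⁻¹ * L⁻¹) * 2) (by positivity)
      ((hρc.continuousOn.mul hwc).mul (hPc.continuousOn.add continuousOn_const)) fun t ht => by
        rw [abs_mul, abs_mul]
        exact mul_le_mul (mul_le_mul (hρB t) (hwB t ht) (abs_nonneg _) zero_le_one) (hPB' t)
          (abs_nonneg _) (by positivity)
    refine this.congr_fun (fun t _ => ?_) measurableSet_Ioi
    push_cast; ring
  have i5 : IntegrableOn (fun t => ((ρ t : ℝ) : ℂ) * emW φ F₁ F₂ t) (Ioi H) :=
    integrableOn_rhoCut_mul_emW_weilMellin hφ hG₁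
  -- the decomposition of `W P`
  have hsplit : ∫ t in Ioi H, emW φ F₁ F₂ t * ((perB2 (φ t) : ℝ) : ℂ) =
      (∫ t in Ioi H, F₂ t * (((1 - ρ t) * v t * P t : ℝ) : ℂ)) -
      (∫ t in Ioi H, F₁ t * (((1 - ρ t) * w t * P t : ℝ) : ℂ)) +
      (∫ t in Ioi H, F₂ t * ((ρ t * v t : ℝ) : ℂ) * ((P t + 1 / 12 : ℝ) : ℂ)) -
      (∫ t in Ioi H, F₁ t * ((ρ t * w t : ℝ) : ℂ) * ((P t + 1 / 12 : ℝ) : ℂ)) -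
      (1 / 12) * ∫ t in Ioi H, ((ρ t : ℝ) : ℂ) * emW φ F₁ F₂ t := by
    have hpt : ∫ t in Ioi H, emW φ F₁ F₂ t * ((perB2 (φ t) : ℝ) : ℂ) =
        ∫ t in Ioi H, (F₂ t * (((1 - ρ t) * v t * P t : ℝ) : ℂ) -
          F₁ t * (((1 - ρ t) * w t * P t : ℝ) : ℂ) +
          F₂ t * ((ρ t * v t : ℝ) : ℂ) * ((P t + 1 / 12 : ℝ) : ℂ) -
          F₁ t * ((ρ t * w t : ℝ) : ℂ) * ((P t + 1 / 12 : ℝ) : ℂ) -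
          (1 / 12) * (((ρ t : ℝ) : ℂ) * emW φ F₁ F₂ t)) := by
      refine setIntegral_congr_fun measurableSet_Ioi fun t _ => ?_
      simp only [emW, hv, hw, hP, hρ]
      push_cast
      ring
    have k12 : Integrable (fun t => F₂ t * (((1 - ρ t) * v t * P t : ℝ) : ℂ) -
        F₁ t * (((1 - ρ t) * w t * P t : ℝ) : ℂ)) (volume.restrict (Ioi H)) := i1.sub i2
    have k123 : Integrable (fun t => F₂ t * (((1 - ρ t) * v t * P t : ℝ) : ℂ) -
        F₁ t * (((1 - ρ t) * w t * P t : ℝ) : ℂ) +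
        F₂ t * ((ρ t * v t : ℝ) : ℂ) * ((P t + 1 / 12 : ℝ) : ℂ)) (volume.restrict (Ioi H)) :=
      k12.add i3
    have k1234 : Integrable (fun t => F₂ t * (((1 - ρ t) * v t * P t : ℝ) : ℂ) -
        F₁ t * (((1 - ρ t) * w t * P t : ℝ) : ℂ) +
        F₂ t * ((ρ t * v t : ℝ) : ℂ) * ((P t + 1 / 12 : ℝ) : ℂ) -
        F₁ t * ((ρ t * w t : ℝ) : ℂ) * ((P t + 1 / 12 : ℝ) : ℂ)) (volume.restrict (Ioi H)) :=
      k123.sub i4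
    have k5 : Integrable (fun t => (1 / 12 : ℂ) * (((ρ t : ℝ) : ℂ) * emW φ F₁ F₂ t))
        (volume.restrict (Ioi H)) := i5.const_mul _
    rw [hpt, integral_sub k1234 k5, integral_sub k123 i4, integral_add k12 i3, integral_sub i1 i2,
      integral_const_mul]
  -- the five kernel identities
  have e1 : ∫ t in Ioi H, F₂ t * (((1 - ρ t) * v t * P t : ℝ) : ℂ) = ∫ x, G₂ x * Nv x :=
    hNv_id G₂ hG₂.1.continuous hG₂.2
  have e2 : ∫ t in Ioi H, F₁ t * (((1 - ρ t) * w t * P t : ℝ) : ℂ) = ∫ x, G₁ x * Nw x :=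
    hNw_id G₁ hG₁.1.continuous hG₁.2
  have e3 : ∫ t in Ioi H, F₂ t * ((ρ t * v t : ℝ) : ℂ) * ((P t + 1 / 12 : ℝ) : ℂ) =
      ∫ x, G₂ x * Kv x := hKv_id G₂ hG₂ hG₂a
  have e4 : ∫ t in Ioi H, F₁ t * ((ρ t * w t : ℝ) : ℂ) * ((P t + 1 / 12 : ℝ) : ℂ) =
      ∫ x, G₁ x * Kw x := hKw_id G₁ hG₁ hG₁a
  have e5 : ∫ t in Ioi H, ((ρ t : ℝ) : ℂ) * emW φ F₁ F₂ t = -∫ x, G₁ x * Z x := by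
    rw [hφ.integral_rhoCut_mul_emW (hasDerivAt_weilMellin_line hG₁) i5
      (tendsto_weilMellin_line_zero hG₁), hZ_id G₁ hG₁.1.continuous hG₁.2]
  -- the boundary term
  have e0 : weilMellin h (1 / 2 + H * I) / 2 =
      ∫ x, h x * (cexp (((x * H : ℝ) : ℂ) * I) / 2) := by
    rw [weilMellin_half_eq_integral, ← integral_div]
    exact integral_congr_ae (Eventually.of_forall fun x => by ring)
  -- expand `∫ h Ψ`
  have hGi : ∀ {G k : ℝ → ℂ}, Continuous G → HasCompactSupport G → Continuous k →
      Integrable (fun x => G x * k x) := fun hG hGs hk =>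
    (hG.mul hk).integrable_of_hasCompactSupport hGs.mul_right
  have hhc := hh.1.continuous
  have hG₁c := hG₁.1.continuous
  have hG₂c := hG₂.1.continuous
  have j0 : Integrable (fun x => h x * (cexp (((x * H : ℝ) : ℂ) * I) / 2)) :=
    hGi hhc hh.2 (hexp.continuous.div_const 2)
  have j1 : Integrable (fun x => G₁ x * Nw x) := hGi hG₁c hG₁.2 hNw.continuous
  have j2 : Integrable (fun x => G₁ x * Kw x) := hGi hG₁c hG₁.2 hKw.continuous
  have j3 : Integrable (fun x => G₁ x * Z x) := hGi hG₁c hG₁.2 hZ.continuous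
  have j4 : Integrable (fun x => G₂ x * Nv x) := hGi hG₂c hG₂.2 hNv.continuous
  have j5 : Integrable (fun x => G₂ x * Kv x) := hGi hG₂c hG₂.2 hKv.continuous
  have j12 : Integrable (fun x => G₁ x * Nw x + G₁ x * Kw x) := j1.add j2
  have j3' : Integrable (fun x => (1 / 12 : ℂ) * (G₁ x * Z x)) := j3.const_mul _
  have j123 : Integrable (fun x => G₁ x * Nw x + G₁ x * Kw x - (1 / 12) * (G₁ x * Z x)) :=
    j12.sub j3'
  have j4' : Integrable (fun x => -(G₂ x * Nv x)) := j4.neg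
  have j45 : Integrable (fun x => -(G₂ x * Nv x) - G₂ x * Kv x) := j4'.sub j5
  have j0123 : Integrable (fun x => h x * (cexp (((x * H : ℝ) : ℂ) * I) / 2) +
      (G₁ x * Nw x + G₁ x * Kw x - (1 / 12) * (G₁ x * Z x))) := j0.add j123
  have eΨ : ∫ x, h x * (cexp (((x * H : ℝ) : ℂ) * I) / 2 + I * x * (Nw x + Kw x - Z x / 12) +
      (I * x) ^ 2 * (-Nv x - Kv x)) =
      (∫ x, h x * (cexp (((x * H : ℝ) : ℂ) * I) / 2)) +
      ((∫ x, G₁ x * Nw x) + (∫ x, G₁ x * Kw x) - (1 / 12) * ∫ x, G₁ x * Z x) +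
      (-(∫ x, G₂ x * Nv x) - ∫ x, G₂ x * Kv x) := by
    have hpt : (fun x : ℝ => h x * (cexp (((x * H : ℝ) : ℂ) * I) / 2 +
        I * x * (Nw x + Kw x - Z x / 12) + (I * x) ^ 2 * (-Nv x - Kv x))) =
        fun x => h x * (cexp (((x * H : ℝ) : ℂ) * I) / 2) +
          (G₁ x * Nw x + G₁ x * Kw x - (1 / 12) * (G₁ x * Z x)) +
          (-(G₂ x * Nv x) - G₂ x * Kv x) := by
      funext x; simp only [hG₂def, hG₁def]; ring
    rw [hpt, integral_add j0123 j45, integral_add j0 j123, integral_sub j12 j3', integral_add j1 j2,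
      integral_const_mul, integral_sub j4' j5, integral_neg]
  beta_reduce
  rw [eΨ, e0, hsplit, e1, e2, e3, e4, e5]
  ring

end Remainder

end Literature.NumberTheory.LFunctions
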